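import Mathlib.Analysis.Fourier.Convolution
import Literature.Analysis.UnboundedOperators.UnitaryGroupSmearing
import Literature.Analysis.UnboundedOperators.FourierSpectrumSupportProofs
import HarnessLib

/-!
# Schwartz functional calculus of a one-parameter unitary group through its Fourier spectrum

Topic `Literature/Analysis/UnboundedOperators`, proofs layer over `FourierSpectrum.lean` and
`UnitaryGroupSmearing.lean`. For a strongly continuous one-parameter unitary group
`U(t) = exp (itH)` (`H = U.hamiltonian`, the Stone generator) and a Schwartz function `h` on the
line, the smeared operator `U[𝓕h] = ∫ 𝓕h(a) U(a) da` is, under the SNAG/spectral theorem, the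
function `h(H/2π)` of the Hamiltonian (Streater–Wightman §2-6: `∫ ρ(a) U(a,1) da = ∫ ρ̃(p) dE(p)`).
We prove the three rules of this calculus directly, without any spectral theorem:

* `fourierMatrixCoeff_eq_inner`: the distributional Fourier transform of a matrix coefficient
  (`UnitaryRep.fourierMatrixCoeff`) is `g ↦ ⟪φ, U[𝓕g] ψ⟫`;
* `hamiltonian_integral_fourier_smul_appReal` (**multiplier rule**): `U[𝓕h] x ∈ D(H)` and
  `H U[𝓕h] x = U[𝓕(2πξ h)] x` for `x ∈ D(H)` (integration by parts and `i (𝓕h)' = 𝓕(2πξ h)`);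
* `inner_integral_fourier_integral_fourier` (**product/adjoint rule**):
  `⟪U[𝓕h] φ, U[𝓕h₁] ψ⟫ = ⟪φ, U[𝓕(h̄ h₁)] ψ⟫` (`U[k]* = U[k†]`, `(𝓕h)† = 𝓕h̄`, and
  `𝓕h̄ ⋆ 𝓕h₁ = 𝓕(h̄ h₁)`);
* consequences: the quadratic form of `H - c` on a smeared vector,
  `⟪y, Hy⟫ - c ⟪y, y⟫ = ⟪x, U[𝓕(h̄ (2πξ - c) h)] x⟫` for `y = U[𝓕h] x`
  (`inner_hamiltonian_sub_eq`), and positivity of squares,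
  `⟪x, U[𝓕(s q̄ q)] x⟫ = s ⟪U[𝓕q] x, U[𝓕q] x⟫` (`inner_integral_fourier_conj_mul_self`).

These are the ingredients of the SNAG-free proof that the form bounds of `H` are equivalent to the
support properties of the Fourier-transformed matrix coefficients
(`FourierSpectrumGapProofs.lean`).

## References

* R. F. Streater, A. S. Wightman, *PCT, Spin and Statistics, and All That*, §2-6,
  (2-113)–(2-114). [StreaterWightman1964]
* M. Reed, B. Simon, *Methods of Modern Mathematical Physics II*, §IX.1 (Fourier transform on
  `𝒮`, `(𝓕f)' = 𝓕(-2πiξ f)`, convolution theorem). [ReedSimonII1975]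
* W. Arveson, On groups of automorphisms of operator algebras, J. Funct. Anal. 15 (1974) 217–243
  (spectral subspaces via `∫ f(t) U_t dt`); G. K. Pedersen, *C\*-algebras and their automorphism
  groups* (1979), §8.1.

## Design notes

* Theorems only. Complex conjugates `h̄` of Schwartz functions are supplied existentially
  (`exists_schwartz_conj`) and consumed through the pointwise hypothesis `∀ x, hc x = conj (h x)`;
  real multipliers act through the real-scalar `SchwartzMap.smulLeftCLM`.
-/

noncomputable section

open Filter MeasureTheory Complex
open scoped InnerProductSpace Topology ComplexConjugate SchwartzMap FourierTransform

namespace Literature.Analysis.UnboundedOperators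

/-! ### Fourier identities on `𝓢(ℝ, ℂ)` -/

/-- `𝓕 (conj f) (a) = conj (𝓕 f (-a))` for any `f : ℝ → ℂ` (conjugate the defining integral;
Reed–Simon II, §IX.1). [folklore] -/
theorem fourier_conj_neg (f : ℝ → ℂ) (a : ℝ) :
    𝓕 (fun x => conj (f x)) a = conj (𝓕 f (-a)) := by
  rw [Real.fourier_real_eq, Real.fourier_real_eq, ← integral_conj]
  refine integral_congr_ae (Eventually.of_forall fun v => ?_)
  simp only [Circle.smul_def, smul_eq_mul, map_mul, mul_neg, neg_neg]
  rw [← Circle.coe_inv_eq_conj, ← AddChar.map_neg_eq_inv]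

/-- The complex conjugate of a Schwartz function is a Schwartz function (postcomposition with the
real-linear isometry `conj`). [folklore] -/
theorem exists_schwartz_conj (h : 𝓢(ℝ, ℂ)) : ∃ hc : 𝓢(ℝ, ℂ), ∀ x, hc x = conj (h x) :=
  ⟨SchwartzMap.postcompCLM (Complex.conjCLE : ℂ ≃L[ℝ] ℂ).toContinuousLinearMap h, fun x => by
    rw [SchwartzMap.postcompCLM_apply]
    rfl⟩

/-- `𝓕 h̄ (a) = conj (𝓕 h (-a))` for Schwartz `h` (the adjoint kernel `(𝓕h)†` is `𝓕h̄`).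
[folklore] -/
theorem fourier_schwartz_conj {h hc : 𝓢(ℝ, ℂ)} (hhc : ∀ x, hc x = conj (h x)) (a : ℝ) :
    (𝓕 hc : 𝓢(ℝ, ℂ)) a = conj ((𝓕 h : 𝓢(ℝ, ℂ)) (-a)) := by
  have hcoe : (hc : ℝ → ℂ) = fun x => conj (h x) := funext hhc
  change (𝓕 hc : 𝓢(ℝ, ℂ)) a = conj (((𝓕 h : 𝓢(ℝ, ℂ)) : ℝ → ℂ) (-a))
  rw [SchwartzMap.fourier_coe, SchwartzMap.fourier_coe, hcoe]
  exact fourier_conj_neg _ _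

/-- `∫ 𝓕g = g(0)` for Schwartz `g` (`∫ 𝓕g = 𝓕𝓕g (0) = g(-0)`). [folklore] -/
theorem integral_fourier_schwartz (g : 𝓢(ℝ, ℂ)) : ∫ a, (𝓕 g : 𝓢(ℝ, ℂ)) a = g 0 := by
  have h1 : (𝓕 (𝓕 g : 𝓢(ℝ, ℂ)) : 𝓢(ℝ, ℂ)) 0 = g 0 := by
    have := congrFun (UnitaryRep.coe_fourier_fourier_eq_comp_neg g) 0
    simpa using this
  have h2 : 𝓕 ((𝓕 g : 𝓢(ℝ, ℂ)) : ℝ → ℂ) 0 = ∫ a, (𝓕 g : 𝓢(ℝ, ℂ)) a := by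
    rw [Real.fourier_real_eq]
    simp
  calc ∫ a, (𝓕 g : 𝓢(ℝ, ℂ)) a = 𝓕 ((𝓕 g : 𝓢(ℝ, ℂ)) : ℝ → ℂ) 0 := h2.symm
    _ = (𝓕 (𝓕 g : 𝓢(ℝ, ℂ)) : 𝓢(ℝ, ℂ)) 0 := rfl
    _ = g 0 := h1

/-- **Convolution theorem for Fourier transforms of Schwartz functions**:
`(𝓕f ⋆ 𝓕g)(s) = ∫ 𝓕f(t) 𝓕g(s - t) dt = 𝓕(f g)(s)` (Mathlib's `SchwartzMap.fourier_convolution`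
read backwards through `𝓕𝓕f = f(-·)`; Reed–Simon II, Thm IX.3). [cite: ReedSimonII1975, §IX.1] -/
theorem integral_fourier_mul_fourier_sub (f g : 𝓢(ℝ, ℂ)) (s : ℝ) :
    ∫ t, (𝓕 f : 𝓢(ℝ, ℂ)) t * (𝓕 g : 𝓢(ℝ, ℂ)) (s - t) =
      (𝓕 (SchwartzMap.smulLeftCLM ℂ (f : ℝ → ℂ) g) : 𝓢(ℝ, ℂ)) s := by
  have hconv : SchwartzMap.convolution (ContinuousLinearMap.mul ℂ ℂ) (𝓕 f : 𝓢(ℝ, ℂ))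
      (𝓕 g : 𝓢(ℝ, ℂ)) = 𝓕 (SchwartzMap.smulLeftCLM ℂ (f : ℝ → ℂ) g) := by
    have h1 : (𝓕 (SchwartzMap.convolution (ContinuousLinearMap.mul ℂ ℂ) (𝓕 f : 𝓢(ℝ, ℂ))
        (𝓕 g : 𝓢(ℝ, ℂ))) : 𝓢(ℝ, ℂ)) =
        𝓕 (𝓕 (SchwartzMap.smulLeftCLM ℂ (f : ℝ → ℂ) g) : 𝓢(ℝ, ℂ)) := by
      rw [SchwartzMap.fourier_convolution]
      ext x
      rw [SchwartzMap.pairing_apply_apply, ContinuousLinearMap.mul_apply',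
        congrFun (UnitaryRep.coe_fourier_fourier_eq_comp_neg f) x,
        congrFun (UnitaryRep.coe_fourier_fourier_eq_comp_neg g) x,
        congrFun (UnitaryRep.coe_fourier_fourier_eq_comp_neg _) x]
      simp [SchwartzMap.smulLeftCLM_apply_apply f.hasTemperateGrowth]
    have := congrArg (fun F : 𝓢(ℝ, ℂ) => (𝓕⁻ F : 𝓢(ℝ, ℂ))) h1
    simpa only [FourierTransform.fourierInv_fourier_eq] using this
  rw [← hconv, SchwartzMap.convolution_apply]
  rfl

/-- **Derivative rule** `i (𝓕h)' = 𝓕(2πξ h)` on `𝓢(ℝ, ℂ)` (Mathlib's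
`SchwartzMap.lineDerivOp_fourier_eq` in direction `1`; Reed–Simon II, §IX.1).
[cite: ReedSimonII1975, §IX.1] -/
theorem I_mul_deriv_fourier (h : 𝓢(ℝ, ℂ)) (a : ℝ) :
    Complex.I * deriv ((𝓕 h : 𝓢(ℝ, ℂ)) : ℝ → ℂ) a =
      (𝓕 (SchwartzMap.smulLeftCLM ℂ (fun ξ : ℝ => 2 * Real.pi * ξ) h) : 𝓢(ℝ, ℂ)) a := by
  have htemp1 : (fun ξ : ℝ => inner ℝ ξ (1 : ℝ)).HasTemperateGrowth := by fun_prop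
  have htemp2 : (fun ξ : ℝ => 2 * Real.pi * ξ).HasTemperateGrowth := by fun_prop
  -- the line derivative in direction `1` is the derivative
  have hline : (LineDeriv.lineDerivOp (1 : ℝ) (𝓕 h : 𝓢(ℝ, ℂ)) : 𝓢(ℝ, ℂ)) a =
      deriv ((𝓕 h : 𝓢(ℝ, ℂ)) : ℝ → ℂ) a := by
    rw [SchwartzMap.lineDerivOp_apply, lineDeriv]
    simp only [smul_eq_mul, mul_one]
    rw [deriv_comp_const_add, add_zero]
  have hD : (LineDeriv.lineDerivOp (1 : ℝ) (𝓕 h : 𝓢(ℝ, ℂ)) : 𝓢(ℝ, ℂ)) a =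
      (𝓕 (-(2 * Real.pi * Complex.I) •
        SchwartzMap.smulLeftCLM ℂ (fun ξ : ℝ => inner ℝ ξ (1 : ℝ)) h) : 𝓢(ℝ, ℂ)) a := by
    rw [SchwartzMap.lineDerivOp_fourier_eq]
  rw [hline, FourierTransform.fourier_smul, smul_apply, smul_eq_mul] at hD
  -- identify the multipliers: `2πξ h = (2π) • (⟪ξ, 1⟫ h)`
  have hmul : SchwartzMap.smulLeftCLM ℂ (fun ξ : ℝ => 2 * Real.pi * ξ) h =
      (2 * Real.pi : ℝ) • SchwartzMap.smulLeftCLM ℂ (fun ξ : ℝ => inner ℝ ξ (1 : ℝ)) h := by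
    ext ξ
    rw [SchwartzMap.smulLeftCLM_apply_apply htemp2, smul_apply,
      SchwartzMap.smulLeftCLM_apply_apply htemp1, RCLike.inner_apply, conj_trivial, one_mul,
      smul_smul]
  set X : ℂ := (𝓕 (SchwartzMap.smulLeftCLM ℂ (fun ξ : ℝ => inner ℝ ξ (1 : ℝ)) h) : 𝓢(ℝ, ℂ)) a
    with hX
  rw [hD, hmul, FourierTransform.fourier_smul, smul_apply, Complex.real_smul]
  push_cast
  linear_combination (-2 * (Real.pi : ℂ) * X) * Complex.I_sq

namespace UnitaryRep

variable {H : Type*} [NormedAddCommGroup H] [InnerProductSpace ℂ H] [CompleteSpace H]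

/-! ### Matrix coefficients and smeared operators -/

/-- The distributional Fourier transform of the matrix coefficient is the matrix coefficient of the
smeared operator: `U.fourierMatrixCoeff φ ψ g = ⟪φ, ∫ 𝓕g(a) • U(a)ψ da⟫`
(Streater–Wightman §2-6). [cite: StreaterWightman1964, §2-6 eqs. (2-113)–(2-114)] -/
theorem fourierMatrixCoeff_eq_inner (U : OneParameterUnitaryGroup H) (φ ψ : H) (g : 𝓢(ℝ, ℂ)) :
    U.fourierMatrixCoeff φ ψ g = ⟪φ, ∫ a, (𝓕 g : 𝓢(ℝ, ℂ)) a • U.appReal a ψ⟫_ℂ := by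
  rw [fourierMatrixCoeff_apply, inner_integral_smul_appReal U (𝓕 g : 𝓢(ℝ, ℂ)).integrable]
  rfl

/-- A vector all of whose matrix coefficients vanish is zero: if `⟪φ, ∫ 𝓕g(a) • U(a)ψ da⟫ = 0`
for all `φ` then `∫ 𝓕g(a) • U(a)ψ da = 0`. [folklore] -/
theorem integral_fourier_smul_appReal_eq_zero_of_forall_fourierMatrixCoeff
    (U : OneParameterUnitaryGroup H) {ψ : H} {g : 𝓢(ℝ, ℂ)}
    (h : ∀ φ, U.fourierMatrixCoeff φ ψ g = 0) :
    ∫ a, (𝓕 g : 𝓢(ℝ, ℂ)) a • U.appReal a ψ = 0 := by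
  rw [← @inner_self_eq_zero ℂ, ← fourierMatrixCoeff_eq_inner]
  exact h _

/-! ### The multiplier rule -/

/-- **Smeared operators commute with the Hamiltonian**: for `x ∈ D(H)` and integrable `k`,
`∫ k(a) • U(a)x da ∈ D(H)` and `H ∫ k(a) • U(a)x da = ∫ k(a) • U(a)(H x) da`
(`H = -iA` and `UnitaryRep.integral_smul_appReal_mem_generator_domain`). [folklore] -/
theorem hamiltonian_integral_smul_appReal (U : OneParameterUnitaryGroup H) {k : ℝ → ℂ}
    (hk : Integrable k) (x : U.hamiltonian.domain) :
    ∃ hy : (∫ a, k a • U.appReal a (x : H)) ∈ U.hamiltonian.domain,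
      U.hamiltonian ⟨_, hy⟩ = ∫ a, k a • U.appReal a (U.hamiltonian x) := by
  obtain ⟨hy, hA⟩ := U.integral_smul_appReal_mem_generator_domain hk x
  refine ⟨hy, ?_⟩
  rw [hamiltonian_apply, hamiltonian_apply, integral_smul_appReal_smul]
  exact congrArg (fun v => (-Complex.I) • v) hA

/-- **Multiplier rule** `H U[𝓕h] x = U[𝓕(2πξ h)] x`: for `x ∈ D(H)` and Schwartz `h`,
`∫ 𝓕h(a) • U(a)x da ∈ D(H)` and
`H ∫ 𝓕h(a) • U(a)x da = ∫ 𝓕(2πξ h)(a) • U(a)x da` (`H U[𝓕h]x = -i U[𝓕h] Ax = i U[(𝓕h)'] x` by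
integration by parts, and `i(𝓕h)' = 𝓕(2πξ h)`; under SNAG this is `H h(H/2π) = (2πξ h)(H/2π)`,
Streater–Wightman §2-6). [cite: StreaterWightman1964, §2-6 eqs. (2-113)–(2-114)] -/
theorem hamiltonian_integral_fourier_smul_appReal (U : OneParameterUnitaryGroup H)
    (h : 𝓢(ℝ, ℂ)) (x : U.hamiltonian.domain) :
    ∃ hy : (∫ a, (𝓕 h : 𝓢(ℝ, ℂ)) a • U.appReal a (x : H)) ∈ U.hamiltonian.domain,
      U.hamiltonian ⟨_, hy⟩ =
        ∫ a, (𝓕 (SchwartzMap.smulLeftCLM ℂ (fun ξ : ℝ => 2 * Real.pi * ξ) h) : 𝓢(ℝ, ℂ)) a •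
          U.appReal a (x : H) := by
  obtain ⟨hy, hA⟩ :=
    U.integral_smul_appReal_mem_generator_domain (𝓕 h : 𝓢(ℝ, ℂ)).integrable x
  refine ⟨hy, ?_⟩
  rw [hamiltonian_apply]
  -- `A U[𝓕h] x = U[𝓕h] A x = -U[(𝓕h)'] x`
  have hA' : OneParameterGroup.generator U.toStrongContRepresentation
      (⟨_, hy⟩ : U.hamiltonian.domain) =
      -∫ a, deriv ((𝓕 h : 𝓢(ℝ, ℂ)) : ℝ → ℂ) a • U.appReal a (x : H) :=
    hA.trans (U.integral_smul_appReal_generator_eq_neg (𝓕 h) x)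
  rw [hA', smul_neg, ← neg_smul, neg_neg, ← integral_smul]
  refine integral_congr_ae (Eventually.of_forall fun a => ?_)
  simp only
  rw [smul_smul, I_mul_deriv_fourier]

/-! ### The product/adjoint rule -/

/-- **Product/adjoint rule** `⟪U[𝓕h] φ, U[𝓕h₁] ψ⟫ = ⟪φ, U[𝓕(h̄ h₁)] ψ⟫`: the adjoint of `U[𝓕h]`
is `U[𝓕h̄]` (`U[k]* = U[k†]`, `(𝓕h)† = 𝓕h̄`) and `U[𝓕h̄] U[𝓕h₁] = U[𝓕h̄ ⋆ 𝓕h₁] = U[𝓕(h̄ h₁)]`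
(convolution theorem). [cite: StreaterWightman1964, §2-6 eqs. (2-113)–(2-114)] -/
theorem inner_integral_fourier_integral_fourier (U : OneParameterUnitaryGroup H)
    {h hc : 𝓢(ℝ, ℂ)} (hhc : ∀ x, hc x = conj (h x)) (h₁ : 𝓢(ℝ, ℂ)) (φ ψ : H) :
    ⟪∫ a, (𝓕 h : 𝓢(ℝ, ℂ)) a • U.appReal a φ, ∫ a, (𝓕 h₁ : 𝓢(ℝ, ℂ)) a • U.appReal a ψ⟫_ℂ =
      ⟪φ, ∫ a, (𝓕 (SchwartzMap.smulLeftCLM ℂ (hc : ℝ → ℂ) h₁) : 𝓢(ℝ, ℂ)) a •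
        U.appReal a ψ⟫_ℂ := by
  rw [U.inner_integral_smul_appReal_left (𝓕 h : 𝓢(ℝ, ℂ)).integrable]
  simp_rw [show ∀ a : ℝ, conj ((𝓕 h : 𝓢(ℝ, ℂ)) (-a)) = (𝓕 hc : 𝓢(ℝ, ℂ)) a from
    fun a => (fourier_schwartz_conj hhc a).symm]
  rw [U.integral_smul_appReal_integral_smul_appReal (𝓕 hc : 𝓢(ℝ, ℂ)).integrable
    (𝓕 h₁ : 𝓢(ℝ, ℂ)).integrable]
  simp_rw [integral_fourier_mul_fourier_sub hc h₁]

/-- **Positivity of squares**: if `P = s q̄ q` pointwise for Schwartz `q`, `P` and a constant `s`,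
then `⟪x, ∫ 𝓕P(a) • U(a)x da⟫ = s ⟪v, v⟫` with `v = ∫ 𝓕q(a) • U(a)x da`
(`U[𝓕(q̄q)] = U[𝓕q]* U[𝓕q]`).
[folklore] -/
theorem inner_integral_fourier_conj_mul_self (U : OneParameterUnitaryGroup H)
    {q P : 𝓢(ℝ, ℂ)} {s : ℂ} (hP : ∀ ξ, P ξ = s * (conj (q ξ) * q ξ)) (x : H) :
    ⟪x, ∫ a, (𝓕 P : 𝓢(ℝ, ℂ)) a • U.appReal a x⟫_ℂ =
      s * ⟪∫ a, (𝓕 q : 𝓢(ℝ, ℂ)) a • U.appReal a x,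
        ∫ a, (𝓕 q : 𝓢(ℝ, ℂ)) a • U.appReal a x⟫_ℂ := by
  obtain ⟨qc, hqc⟩ := exists_schwartz_conj q
  have hPq : P = s • SchwartzMap.smulLeftCLM ℂ (qc : ℝ → ℂ) q := by
    ext ξ
    rw [hP ξ, smul_apply, SchwartzMap.smulLeftCLM_apply_apply qc.hasTemperateGrowth,
      hqc ξ, smul_eq_mul, smul_eq_mul]
  rw [hPq, FourierTransform.fourier_smul, U.inner_integral_fourier_integral_fourier hqc q x x,
    ← inner_smul_right, ← integral_smul]
  congr 1
  refine integral_congr_ae (Eventually.of_forall fun a => ?_)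
  simp only [smul_apply, smul_assoc]

/-- **The quadratic form of `H - c` on a smeared vector**: for `x ∈ D(H)`, Schwartz `h` with
conjugate `h̄`, real `c`, and `y = ∫ 𝓕h(a) • U(a)x da`,
`⟪y, H y⟫ - c ⟪y, y⟫ = ⟪x, ∫ 𝓕(h̄ (2πξ - c) h)(a) • U(a)x da⟫`
(multiplier rule and product rule; under SNAG both sides are `∫ |h(λ/2π)|² (λ - c) dμ_x(λ)`).
[folklore] -/
theorem inner_hamiltonian_sub_eq (U : OneParameterUnitaryGroup H) {h hc : 𝓢(ℝ, ℂ)}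
    (hhc : ∀ x, hc x = conj (h x)) (c : ℝ) (x : U.hamiltonian.domain)
    (hy : (∫ a, (𝓕 h : 𝓢(ℝ, ℂ)) a • U.appReal a (x : H)) ∈ U.hamiltonian.domain) :
    ⟪∫ a, (𝓕 h : 𝓢(ℝ, ℂ)) a • U.appReal a (x : H), U.hamiltonian ⟨_, hy⟩⟫_ℂ -
        (c : ℂ) * ⟪∫ a, (𝓕 h : 𝓢(ℝ, ℂ)) a • U.appReal a (x : H),
          ∫ a, (𝓕 h : 𝓢(ℝ, ℂ)) a • U.appReal a (x : H)⟫_ℂ =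
      ⟪(x : H), ∫ a, (𝓕 (SchwartzMap.smulLeftCLM ℂ (hc : ℝ → ℂ)
        (SchwartzMap.smulLeftCLM ℂ (fun ξ : ℝ => 2 * Real.pi * ξ - c) h)) : 𝓢(ℝ, ℂ)) a •
          U.appReal a (x : H)⟫_ℂ := by
  have htemp1 : (fun ξ : ℝ => 2 * Real.pi * ξ).HasTemperateGrowth := by fun_prop
  have htemp2 : (fun ξ : ℝ => 2 * Real.pi * ξ - c).HasTemperateGrowth := by fun_prop
  obtain ⟨hy', hHy⟩ := U.hamiltonian_integral_fourier_smul_appReal h x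
  have hi1 : Integrable fun a => (𝓕 (SchwartzMap.smulLeftCLM ℂ (hc : ℝ → ℂ)
      (SchwartzMap.smulLeftCLM ℂ (fun ξ : ℝ => 2 * Real.pi * ξ) h)) : 𝓢(ℝ, ℂ)) a •
        U.appReal a (x : H) :=
    U.integrable_smul_appReal (SchwartzMap.integrable _) _
  have hi2 : Integrable fun a => (c : ℂ) •
      ((𝓕 (SchwartzMap.smulLeftCLM ℂ (hc : ℝ → ℂ) h) : 𝓢(ℝ, ℂ)) a • U.appReal a (x : H)) :=
    (U.integrable_smul_appReal (SchwartzMap.integrable _) _).smul (c : ℂ)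
  rw [hHy, U.inner_integral_fourier_integral_fourier hhc _ (x : H) (x : H),
    U.inner_integral_fourier_integral_fourier hhc h (x : H) (x : H), ← inner_smul_right,
    ← inner_sub_right, ← integral_smul, ← integral_sub hi1 hi2]
  congr 1
  refine integral_congr_ae (Eventually.of_forall fun a => ?_)
  simp only
  rw [smul_smul, ← sub_smul]
  congr 1
  -- the kernels: `𝓕(h̄ (2πξ) h) - c 𝓕(h̄ h) = 𝓕(h̄ (2πξ - c) h)` at `a`
  have hker : SchwartzMap.smulLeftCLM ℂ (hc : ℝ → ℂ)
        (SchwartzMap.smulLeftCLM ℂ (fun ξ : ℝ => 2 * Real.pi * ξ - c) h) =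
      SchwartzMap.smulLeftCLM ℂ (hc : ℝ → ℂ)
          (SchwartzMap.smulLeftCLM ℂ (fun ξ : ℝ => 2 * Real.pi * ξ) h) +
        (-(c : ℂ)) • SchwartzMap.smulLeftCLM ℂ (hc : ℝ → ℂ) h := by
    ext ξ
    simp only [add_apply, smul_apply,
      SchwartzMap.smulLeftCLM_apply_apply hc.hasTemperateGrowth,
      SchwartzMap.smulLeftCLM_apply_apply htemp1, SchwartzMap.smulLeftCLM_apply_apply htemp2,
      smul_eq_mul, Complex.real_smul]
    push_cast
    ring
  rw [hker, FourierTransform.fourier_add, FourierTransform.fourier_smul, add_apply, smul_apply,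
    smul_eq_mul]
  ring

end UnitaryRep

end Literature.Analysis.UnboundedOperators
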